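import Literature.MathematicalPhysics.QuantumFieldTheory.BalabanImbrieJaffe1984to88.BIJ88Sect3Statements
import Literature.MathematicalPhysics.QuantumFieldTheory.Balaban1983to89.LatticeFieldCalculus

/-!
# `BalabanImbrieJaffe1984to88.BIJ88Sect4Statements` — T. Bałaban, J. Imbrie, A. Jaffe, *Effective action and cluster
properties of the abelian Higgs model*, Commun. Math. Phys. **114** (1988) 257–315 [BalabanImbrieJaffe1988]:
Sect. 4 "The Inductive Hypothesis" (pp. 273–277): the stopping scale `ε₀` and the correlation length `l` (p. 273), the
background field (4.2) and its smoothness (4.3), the bond products (4.4), the small-field restrictions (4.5), the constants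
(4.7), (4.8), (4.10), (4.11) of the Gaussian normalization factors, the external fields (4.12)–(4.13), the dominant scalar term
`P_k` (4.14) with its bounds (4.15), and the two gauge invariances (4.16) (background) and (4.17) (block field).

statement-level skeleton of published theorems with citation tags; proofs where landed; nothing here is a claim about the Yang–Mills mass gap

PDF held: `paper:balaban1988-cmp114-bij-abelian-higgs-effective-action` (journal page = PDF page + 256).  Renders read as
images (poppler, ×3): PDF pp. 17–21 (journal 273–277).

CITATION HEADER (lean-in-tree rule).  Part of the lit-balaban TYPED SKELETON (HOME `run/shared/lean/pub/lit-balaban/`; rows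
`C2.Def@273`, `C2.Eq4.1` … `C2.Eq4.17` of `HOME/lit-balaban-r18/ROWS-C2.md`; unit `lit-balaban-r18`).  WHAT IS REPRODUCED, and how.
(a) DEFINITIONS WITH BODIES: `ε₀`, `l` (p. 273), (4.2) (over abstract bond data), (4.4) (= the tree's straight-line product
`AveragingRT.axialAvg`, iterated), (4.7), (4.8), (4.10), (4.11), (4.12), (4.13), (4.14), (4.16), (4.17) — on the tori and with the
difference calculus of `Balaban1983to89.Setup`/`LatticeFieldCalculus` and the U(1) carrier of `BIJ88Sect3Statements`.
(b) PROVED: the completed square `P_k(φ) = λ_k(|φ|² − (8λ)⁻¹(L^kε)^{d−2})²` for `λ_k = (L^kε)^{4−d}λ`, d = 2, 3, 4 (`Pk_eq_sq`) — whence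
the ring `|φ| = (8λ)^{−1/2}(L^kε)^{(d−2)/2}` subtracted in (4.5) and `P_k ≥ 0`; the background gauge transformations (4.16) ARE the
gauge transformations of Sect. 3 with parameter `e_kλ` (`bgGaugeU_eq`, `bgGaugePhi_eq`), so every gauge invariant function in the
sense of `BIJ88Sect3Statements.IsGaugeInvariant` is invariant under (4.16) (`bgInvariant_of_isGaugeInvariant`).  (c) STATEMENTS as
`def … : Prop`: (4.3), (4.5), (4.15), the claim `|P_k(φ_k)| ≦ cp(e_k)⁴` of p. 276, the region nesting of p. 274.  v1.1 (append-only): the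
p. 276 claim PROVED for field values obeying (4.5) — `Pk_le_of_ring`, `abs_Pk_le_of_small`, `claim276_of_restr45` (explicit constant).  NOT typed
(rows `absent`, reasons in ROWS-C2.md): the density (4.1) and the Gaussian integrals (4.6), (4.9) (bookkeeping over the regions
Λ^{(j)}_α and the axial δ-functions of [1]); the perturbation expansion `𝒫_{k,loc}` (p. 275: *"which we describe in detail in a later
paper"*).  NOTHING of the paper is asserted beyond the kernel-checked items under (b).
-/

namespace Literature.MathematicalPhysics.QuantumFieldTheory.BalabanImbrieJaffe1984to88.BIJ88Sect4Statements

open Literature.MathematicalPhysics.QuantumFieldTheory.Balaban1983to89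
open BIJ88Sect3Statements
open scoped BigOperators
open Complex

noncomputable section

/-! ## p. 273: the stopping scale and the correlation length -/

/-- p. 273 [PDF 17], verbatim: *"The original lattice T_ε is now T_η, η = L^{−k}, we assume that L^kε < ε₀ = min{1, (8λ/e²)^{1/2}}e^β,
with β > 0 small and e ≪ 1. Thus we are stopping the inductive expansion somewhat before either of the two lengths in the problem
are reached."* — AS PRINTED here (`e^β`, e = the charge); (3.35) p. 270 prints *"ε₀ = ε^β min{1, (8λ/e²)^{1/2}}"* with `ε^β`
(TRANSCRIPTION NOTE: the two displays differ; p. 270 calls ε₀ *"the lattice spacing to terminate the induction"*).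
[cite: BalabanImbrieJaffe1988, (4.1) p.273] -/
def eps0 (lam e β : ℝ) : ℝ := min 1 (Real.sqrt (8 * lam / e ^ 2)) * e ^ β

/-- p. 273 [PDF 17], verbatim: *"When L^kε ≧ ε₀, we apply a final cluster expansion designed to exhibit the Higgs mechanisms. This
will be the subject of the next paper in the series."* — the induction runs while `L^kε < ε₀`. [cite: BalabanImbrieJaffe1988, (4.1) p.273] -/
def Continues (L ε ε₀ : ℝ) (k : ℕ) : Prop := L ^ k * ε < ε₀

/-- p. 273 [PDF 17], verbatim: *"The expected correlation length is of order l = max{1, (8λ/e²)^{1/2}}."*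
[cite: BalabanImbrieJaffe1988, (4.1) p.273] -/
def corrLen (lam e : ℝ) : ℝ := max 1 (Real.sqrt (8 * lam / e ^ 2))

variable {P : Params} {j : ℕ}

/-! ## p. 274: regions, the background field (4.2)–(4.4) -/

/-- p. 274 [PDF 18], verbatim: *"Each X_ω also specifies subsets Λ_α^{(j)} ∩ X_ω for 0 ≦ j ≦ k−1, 0 ≦ α ≦ 13. … we have Λ₀^{(j)} ⊂
Λ₁₃^{(j−1)} for j ≧ 1. … We have Λ_α^{(j)} ⊂ Λ_{α−1}^{(j)}."* — the tower of small-field regions as finite sets of sites of the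
level-j tori, decreasing in α; the cross-level inclusion READ through the blocks of `Setup` (every block of a site of Λ₀^{(j+1)}
lies in Λ₁₃^{(j)}; the paper's Λ̄ = *"the union of L^j-blocks at the points of Λ_α^{(j)}"*). [cite: BalabanImbrieJaffe1988, (4.1) p.274] -/
def RegionTower (Λ : (i : ℕ) → ℕ → Finset (Balaban1983to89.Site P i)) : Prop :=
  (∀ i α, Λ i (α + 1) ⊆ Λ i α) ∧ ∀ i, ∀ y ∈ Λ (i + 1) 0, block y ⊆ Λ i 13

/-- **(4.2)** p. 274 [PDF 18], verbatim: *"The external gauge field appearing throughout the initial density is u_k. It depends on all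
the u^{(j)} [or equivalently, the A^{(j)} = (ie_j)⁻¹ log u^{(j)}]; but in Λ̄₆^{(k−1)*} it simplifies to u_k = (Q^{s*}_k u)
exp(−ie_kη𝒟_{k,loc}∂*Q^{e*}_k f^{(k)}), (4.2) where f^{(k)}(p) = (ie_k)⁻¹ log u(p). This is just a localized version of (I.4.5.4)."* —
pointwise on η-lattice bonds, over the data `Qssu = Q^{s*}_k u` and `g = 𝒟_{k,loc}∂*Q^{e*}_k f^{(k)}` (real bond function);
`f^{(k)}` = `BIJ88Sect3Statements.fieldStrength e_k`. [cite: BalabanImbrieJaffe1988, (4.2) p.274] -/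
def backgroundU {B : Type*} (ek η : ℝ) (Qssu : B → ℂ) (g : B → ℝ) : B → ℂ :=
  fun b => Qssu b * exp (-(I * (ek * η * g b : ℝ)))

/-- **(4.3)** p. 274 [PDF 18], verbatim: *"the configuration is smooth in the sense that for each j < k (and lattice spacing ζ = L^{−j}),
and for each r(e_j)-cube □ in Λ̄₁^{(j)}, there exists a gauge transformation u_k → u_k^λ such that u^λ_{k,b} = exp(ie_jL^{−j}A^λ_b)
with |A^λ_b|, |(∂^ζA^λ)(p)|, |(∂^{ζ*}A^λ)(x)| ≦ cp(e_j)r(e_j) (4.3) in □."* — on the level-j torus of `Setup` (the cube given by its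
sites `X`, bonds `B`, plaquettes `Pl`), gauge transformation `BIJ88Sect3Statements.gaugeU`, `∂^ζ` = `LatticeFieldCalculus.curl ζ⁻¹`,
`∂^{ζ*}` = `diverg ζ⁻¹`. [cite: BalabanImbrieJaffe1988, (4.3) p.274] -/
def Smooth43 (ej ζ c pej rej : ℝ) (X : Finset (Balaban1983to89.Site P j)) (B : Finset (PBond P j))
    (Pl : Finset (Plaq P j)) (u : PBond P j → ℂ) : Prop :=
  ∃ (lam : Balaban1983to89.Site P j → ℝ) (A : Balaban1983to89.VecField P j ℝ),
    (∀ b ∈ B, BIJ88Sect3Statements.gaugeU lam u b = exp (I * (ej * ζ * A b : ℝ))) ∧ (∀ b ∈ B, |A b| ≤ c * pej * rej) ∧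
    (∀ p ∈ Pl, |LatticeFieldCalculus.curl ζ⁻¹ A p| ≤ c * pej * rej) ∧
    ∀ x ∈ X, |LatticeFieldCalculus.diverg ζ⁻¹ A x| ≤ c * pej * rej

/-- **(4.4)** p. 274 [PDF 18], verbatim: *"The configuration u_k on T_η* gives a configuration ū_k on T₁^{(k)*} by taking a product
along the bond in T₁^{(k)*}, i.e., ū_{k,b} = u_k(⟨b₋, b₊⟩). (4.4)"* — ONE level of it is the tree's straight-line product
`AveragingRT.axialAvg` (`ū(c) = Π_{t<L} u(line c t)`); here its k-fold iterate from the η-lattice (level 0) to level k.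
[cite: BalabanImbrieJaffe1988, (4.4) p.274] -/
def barU {G : Type*} [GaugeGroup G] : (k : ℕ) → GaugeField P 0 G → GaugeField P k G
  | 0 => id
  | k + 1 => fun U => AveragingRT.axialAvg (barU k U)

/-! ## (4.5): the restrictions in the small-field region -/

/-- **(4.5)** p. 274 [PDF 18], verbatim: *"The factor χ_{k,Λ₀^{(k−1)′}} gives restrictions on u, φ in Λ₀^{(k−1)′}. The following are
implied by the smoothed characteristic functions in χ_{k,Λ₀^{(k−1)′}}: |f^{(k)}(p)| ≦ cp(e_k), p ∈ Λ₀^{(k−1)′**}, |(D_{ū_k}φ)(b)| ≦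
cp(e_k), b ∈ Λ₀^{(k−1)′*}, |φ(x)| ≦ cλ_k^{−1/4}p(e_k), if (L^{k−1}ε)^d < λ, x ∈ Λ₀^{(k−1)′}, ||φ(x)| − (8λ)^{−1/2}(L^kε)^{(d−2)/2}|
≦ c(L^kε)⁻¹p(e_k), if (L^{k−1}ε)^d ≧ λ, x ∈ Λ₀^{(k−1)′}. (4.5)"* (p. 275: *"We have incorporated some rescaling factors (powers of L)
and the difference between p(e_k) and p(e_{k−1}) into the constant c."*) — on the unit lattice `T₁^{(k)}` (one torus level; the
region by its sites `X`, `X*`, `X**` via `BIJ88Sect3Statements.starB/starP`), `D_{ū_k}` = `covD 1 ū`, scales `s₁ = L^{k−1}ε`,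
`s = L^kε`, `λ_k` as data. [cite: BalabanImbrieJaffe1988, (4.5) p.274] -/
def Restr45 (c pek lamk lam s₁ s : ℝ) (d : ℕ) (X : Finset (Balaban1983to89.Site P j)) (f : Plaq P j → ℝ)
    (ubar : PBond P j → ℂ) (φ : Balaban1983to89.Site P j → ℂ) : Prop :=
  (∀ p ∈ BIJ88Sect3Statements.starP X, |f p| ≤ c * pek) ∧ (∀ b ∈ BIJ88Sect3Statements.starB X, ‖BIJ88Sect3Statements.covD 1 ubar φ b‖ ≤ c * pek) ∧
    (s₁ ^ d < lam → ∀ x ∈ X, ‖φ x‖ ≤ c * lamk ^ (-(1 / 4 : ℝ)) * pek) ∧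
    (lam ≤ s₁ ^ d → ∀ x ∈ X, |‖φ x‖ - (8 * lam) ^ (-(1 / 2 : ℝ)) * s ^ (((d : ℝ) - 2) / 2)| ≤ c * s⁻¹ * pek)

/-! ## (4.6)–(4.13): constants of the normalization factors, external fields -/

/-- **(4.7)** p. 275 [PDF 19], verbatim: *"It is defined using E^{(j)}_{k,v} = −log[(e_j/2π)(L^jη)^{(d−2)/2}], (4.7)"* (the constant of
the gauge-field Gaussian normalization factor (4.6)). [cite: BalabanImbrieJaffe1988, (4.7) p.275] -/
def Ekv (ej Ljη : ℝ) (d : ℕ) : ℝ := -Real.log (ej / (2 * Real.pi) * Ljη ^ (((d : ℝ) - 2) / 2))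

/-- **(4.8)** p. 275 [PDF 19], verbatim: *"‖Λ₁₀^{(j)c*c}‖ = |Λ₁₀^{(j)c*c}| − |Λ₁₀^{(j)′}|(L^d − 1) − |Λ₁₀^{(j)′c*c}|. (4.8) Here ‖Λ₁₀^{(j)c*c}‖
is the number of free integrations in Λ₁₀^{(j)c*c} after enforcing the δ-functions."* — over the three cardinalities.
[cite: BalabanImbrieJaffe1988, (4.8) p.275] -/
def freeCount (nB nSites' nB' L d : ℕ) : ℤ := (nB : ℤ) - nSites' * ((L : ℤ) ^ d - 1) - nB'

/-- **(4.10)** p. 275 [PDF 19], verbatim: *"with P(u_k) = Q(u_k)*Q(u_k), (4.10)"* — in a ring of operators (`Qst` = Q(u_k)*).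
[cite: BalabanImbrieJaffe1988, (4.10) p.275] -/
def Pu {R : Type*} [Ring R] (Q Qst : R) : R := Qst * Q

/-- **(4.11)** p. 275 [PDF 19], verbatim: *"E^{(j)}_{k,s} = −(d−2) log L^jη. (4.11)"* (the constant of the scalar-field normalization
factor (4.9)). [cite: BalabanImbrieJaffe1988, (4.11) p.275] -/
def Eks (d : ℕ) (Ljη : ℝ) : ℝ := -((d : ℝ) - 2) * Real.log Ljη

/-- **(4.12)** p. 275 [PDF 19], verbatim: *"The fields u, φ appear in the diagrams through the η-lattice minimizers u_k and φ_k =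
a_kG_{k,loc}(u_k)Q_k^*(u_k)φ, (4.12)"* — over linear maps `G = G_{k,loc}(u_k)`, `Qs = Q_k^*(u_k)` between the field spaces.
[cite: BalabanImbrieJaffe1988, (4.12) p.275] -/
def phiK {E F : Type*} [AddCommGroup E] [Module ℝ E] [AddCommGroup F] [Module ℝ F] (ak : ℝ) (G : F →ₗ[ℝ] F) (Qs : E →ₗ[ℝ] F)
    (φ : E) : F :=
  ak • G (Qs φ)

/-- **(4.13)** p. 275 [PDF 19], verbatim: *"f_k(p) = (ie_kη²)⁻¹ log u_k(p). (4.13)"* — principal branch of `log`.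
[cite: BalabanImbrieJaffe1988, (4.13) p.275] -/
def fK (ek η : ℝ) (ukp : ℂ) : ℂ := (I * ek * η ^ 2)⁻¹ * log ukp

/-! ## (4.14)–(4.15): the dominant scalar term -/

/-- **(4.14)** p. 276 [PDF 20] (= **(3.8)** p. 266), verbatim: *"The dominant term for the scalar field is P_k(φ_k), where P_k(φ) =
λ_k|φ|⁴ − ¼(L^kε)²|φ|² + (1/64λ)(L^kε)^d. (4.14)"* — `s = L^kε`. [cite: BalabanImbrieJaffe1988, (4.14) p.276] -/
def Pk (lamk s lam : ℝ) (d : ℕ) (z : ℂ) : ℝ := lamk * ‖z‖ ^ 4 - (1 / 4) * s ^ 2 * ‖z‖ ^ 2 + 1 / (64 * lam) * s ^ d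

/-- kernel: with the running coupling `λ_k = (L^kε)^{4−d}λ` of (2.2)/(3.9), in dimensions d = 2, 3, 4, the dominant term is the
completed square `P_k(φ) = λ_k(|φ|² − (8λ)⁻¹(L^kε)^{d−2})²` — nonnegative for λ > 0, vanishing on the ring
`|φ| = (8λ)^{−1/2}(L^kε)^{(d−2)/2}` that (4.5) subtracts. [cite: BalabanImbrieJaffe1988, (4.14) p.276] -/
theorem Pk_eq_sq {lam s : ℝ} (hlam : lam ≠ 0) {d : ℕ} (hd : 2 ≤ d) (hd' : d ≤ 4) (z : ℂ) :
    Pk (s ^ (4 - d) * lam) s lam d z = s ^ (4 - d) * lam * (‖z‖ ^ 2 - s ^ (d - 2) / (8 * lam)) ^ 2 := by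
  unfold Pk
  interval_cases d <;> · field_simp; ring

/-- kernel: hence `0 ≤ P_k` for λ > 0, s = L^kε ≥ 0. [cite: BalabanImbrieJaffe1988, (4.14) p.276] -/
theorem Pk_nonneg {lam s : ℝ} (hlam : 0 < lam) (hs : 0 ≤ s) {d : ℕ} (hd : 2 ≤ d) (hd' : d ≤ 4) (z : ℂ) :
    0 ≤ Pk (s ^ (4 - d) * lam) s lam d z := by
  rw [Pk_eq_sq hlam.ne' hd hd']
  positivity

/-- p. 276 [PDF 20], verbatim: *"Under the restrictions in χ_k, |P_k(φ_k)| ≦ cp(e_k)⁴."* — the restriction as an abstract hypothesis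
`Restr` on the field value. [cite: BalabanImbrieJaffe1988, (4.14) p.276] -/
def Claim276 (c pek : ℝ) (P : ℂ → ℝ) (Restr : ℂ → Prop) : Prop := ∀ z, Restr z → |P z| ≤ c * pek ^ 4

/-- **(4.15)** p. 276 [PDF 20], verbatim: *"At P_k-vertices with l external legs, we have its l-th derivative |P_k^{(l)}(φ_k)| ≦
cλ_k^{l/4}p(e_k)^{4−l}, for (L^kε)^d ≦ λ, |P_k^{(l)}(φ_k)| ≦ c(L^kε)^lp(e_k)^{4−l}, for (L^kε)^d > λ. (4.15)"* — over the sizes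
`DP l` of the l-th derivatives at φ_k (data), `s = L^kε`. [cite: BalabanImbrieJaffe1988, (4.15) p.276] -/
def Ineq415 (c lamk pek s lam : ℝ) (d : ℕ) (DP : ℕ → ℝ) : Prop :=
  ∀ l : ℕ, (s ^ d ≤ lam → |DP l| ≤ c * lamk ^ ((l : ℝ) / 4) * pek ^ ((4 : ℤ) - l)) ∧
    (lam < s ^ d → |DP l| ≤ c * s ^ l * pek ^ ((4 : ℤ) - l))

/-- p. 276 [PDF 20], verbatim: *"In fact all terms except P_k(φ_k) in 𝒫_{k,loc} obey bounds O(e^{β−α}(L^kε/ε₀)^{1/4−α}), with α > 0,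
small, α < β."* — the size of a non-dominant term `T`. [cite: BalabanImbrieJaffe1988, (4.15) p.276] -/
def NonDominantBound (C e β α s ε₀ T : ℝ) : Prop :=
  0 < α ∧ α < β ∧ |T| ≤ C * e ^ (β - α) * (s / ε₀) ^ (1 / 4 - α)

/-! ## (4.16)–(4.17): background and block-field gauge transformations -/

/-- kernel (plumbing): decidability of membership of a bond in a finite set of bonds, through the pair (source, direction). [folklore] -/
private instance instDecEqPBond : DecidableEq (PBond P j) := fun a b =>
  decidable_of_iff (a.src = b.src ∧ a.dir = b.dir)
    ⟨fun h => by cases a; cases b; cases h; congr, fun h => by subst h; exact ⟨rfl, rfl⟩⟩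


/-- **(4.16)** p. 276 [PDF 20], the gauge field, verbatim: *"Finally, we assume that every factor or term in our starting expression
is gauge invariant in the following senses. Gauge transformations u_{k,b} → u_{k,b}e^{−ie_kη(∂^ηλ)(b)}, φ(x) → φ(x)e^{ie_kλ(x)} (4.16)
leave each expression invariant."* — `∂^η` = `LatticeFieldCalculus.grad η⁻¹` on the η-lattice torus.
[cite: BalabanImbrieJaffe1988, (4.16) p.276] -/
def bgGaugeU (ek η : ℝ) (lam : Balaban1983to89.Site P j → ℝ) (u : PBond P j → ℂ) : PBond P j → ℂ :=
  fun b => u b * exp (-(I * (ek * η * LatticeFieldCalculus.grad η⁻¹ lam b : ℝ)))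

/-- **(4.16)**, the scalar field: `φ(x) → φ(x)e^{ie_kλ(x)}`. [cite: BalabanImbrieJaffe1988, (4.16) p.276] -/
def bgGaugePhi (ek : ℝ) (lam : Balaban1983to89.Site P j → ℝ) (φ : Balaban1983to89.Site P j → ℂ) :
    Balaban1983to89.Site P j → ℂ :=
  fun x => φ x * exp (I * (ek * lam x : ℝ))

/-- **(4.16)**: invariance of a function of `(u_k, φ)` under the background gauge transformations (p. 277: *"We call these
transformations background gauge transformations, because the integration variables u^{(j)}, u are not involved."*).
[cite: BalabanImbrieJaffe1988, (4.16) p.276] -/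
def BgInvariant {α : Type*} (ek η : ℝ) (F : (PBond P j → ℂ) → (Balaban1983to89.Site P j → ℂ) → α) : Prop :=
  ∀ (lam : Balaban1983to89.Site P j → ℝ) u φ, F (bgGaugeU ek η lam u) (bgGaugePhi ek lam φ) = F u φ

/-- kernel: for `η ≠ 0` the background gauge transformation of the gauge field IS the gauge transformation of Sect. 3 with
parameter `e_kλ`: `u(b)e^{−ie_kη(∂^ηλ)(b)} = e^{ie_kλ(b₋)}u(b)e^{−ie_kλ(b₊)}`. [cite: BalabanImbrieJaffe1988, (4.16) p.276] -/
theorem bgGaugeU_eq {ek η : ℝ} (hη : η ≠ 0) (lam : Balaban1983to89.Site P j → ℝ) (u : PBond P j → ℂ) :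
    bgGaugeU ek η lam u = BIJ88Sect3Statements.gaugeU (fun x => ek * lam x) u := by
  funext b
  simp only [bgGaugeU, BIJ88Sect3Statements.gaugeU, LatticeFieldCalculus.grad, smul_eq_mul]
  rw [show ek * η * (η⁻¹ * (lam b.tgt - lam b.src)) = ek * lam b.tgt - ek * lam b.src by field_simp]
  rw [show -(I * ((ek * lam b.tgt - ek * lam b.src : ℝ) : ℂ)) = ((ek * lam b.src : ℝ) : ℂ) * I + -(((ek * lam b.tgt : ℝ) : ℂ) * I)
    by push_cast; ring, exp_add]
  ring

/-- kernel: the background gauge transformation of the scalar field is `gaugePhi` of Sect. 3 with parameter `e_kλ`.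
[cite: BalabanImbrieJaffe1988, (4.16) p.276] -/
theorem bgGaugePhi_eq (ek : ℝ) (lam : Balaban1983to89.Site P j → ℝ) (φ : Balaban1983to89.Site P j → ℂ) :
    bgGaugePhi ek lam φ = BIJ88Sect3Statements.gaugePhi (fun x => ek * lam x) φ := by
  funext x
  simp only [bgGaugePhi, BIJ88Sect3Statements.gaugePhi]
  rw [mul_comm (φ x), mul_comm I]

/-- kernel: consequently every gauge invariant function of `(u, φ)` in the sense of Sect. 3 (e.g. the action (3.3),
`BIJ88Sect3Statements.action_gauge`) is invariant under (4.16). [cite: BalabanImbrieJaffe1988, (4.16) p.276] -/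
theorem bgInvariant_of_isGaugeInvariant {α : Type*} {ek η : ℝ} (hη : η ≠ 0)
    {F : (PBond P j → ℂ) → (Balaban1983to89.Site P j → ℂ) → α} (hF : BIJ88Sect3Statements.IsGaugeInvariant F) : BgInvariant ek η F := by
  intro lam u φ
  rw [bgGaugeU_eq hη, bgGaugePhi_eq]
  exact hF _ u φ

/-- **(4.17)** p. 277 [PDF 21], verbatim: *"The second kind of gauge invariance is called block field gauge invariance, and is
invariance under u_b → u_be^{−ie_k(∂λ)(b)}, φ(x) → e^{ie_kλ(x)} [sic: φ(x)e^{ie_kλ(x)}], u_b^{(j)} → u_b^{(j)} exp[−ie_kL^jη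
(∂^{L^jη}Q′*_{k−j}λ)(b)], if b ∈ Λ₁^{(j)*c}, u_b^{(j)} → u_b^{(j)}, otherwise, (4.17) for λ a function on T₁^{(k)}. Here Q′_k denotes
the averaging operator for real-valued functions on sites."* — the transformation of the j-th fluctuation field on the level-j
torus, over the data `Qadj = Q′*_{k−j}` (a map from functions on `T₁^{(k)}` to functions on the `L^jη`-lattice), the exempt region
`Λ₁^{(j)*}` as a finite set of bonds, `ξ = L^jη`; the first line is `bgGaugeU e_k 1`, `bgGaugePhi e_k` on the unit lattice.
[cite: BalabanImbrieJaffe1988, (4.17) p.277] -/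
def blockGaugeUj {k : ℕ} (ek ξ : ℝ) (Qadj : (Balaban1983to89.Site P k → ℝ) → (Balaban1983to89.Site P j → ℝ))
    (Λ₁star : Finset (PBond P j)) (lam : Balaban1983to89.Site P k → ℝ) (uj : PBond P j → ℂ) : PBond P j → ℂ :=
  fun b => if b ∈ Λ₁star then uj b else uj b * exp (-(I * (ek * ξ * LatticeFieldCalculus.grad ξ⁻¹ (Qadj lam) b : ℝ)))

/-- kernel: outside the exempt region nothing changes when `λ` is constant on blocks in the sense `∂^{ξ}(Q′*λ) = 0` there — in
particular for `λ = 0` the transformation (4.17) is the identity. [cite: BalabanImbrieJaffe1988, (4.17) p.277] -/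
theorem blockGaugeUj_zero {k : ℕ} (ek ξ : ℝ) (Qadj : (Balaban1983to89.Site P k → ℝ) →ₗ[ℝ] (Balaban1983to89.Site P j → ℝ))
    (Λ₁star : Finset (PBond P j)) (uj : PBond P j → ℂ) : blockGaugeUj ek ξ Qadj Λ₁star 0 uj = uj := by
  funext b
  by_cases hb : b ∈ Λ₁star
  · simp [blockGaugeUj, hb]
  · simp [blockGaugeUj, hb, LatticeFieldCalculus.grad]

/-! ## v1.1 (append-only): the elementary estimate behind *"Under the restrictions in χ_k, |P_k(φ_k)| ≦ cp(e_k)⁴"* (p. 276) -/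

/-- kernel (plumbing): the square of the printed ring radius, `((8λ)^{−1/2}(L^kε)^{(d−2)/2})² = (L^kε)^{d−2}/(8λ)` (d ≥ 2).
[folklore] -/
private theorem ringRadius_sq {lam s : ℝ} (hlam : 0 < lam) (hs : 0 < s) {d : ℕ} (hd : 2 ≤ d) :
    ((8 * lam) ^ (-(1 / 2 : ℝ)) * s ^ (((d : ℝ) - 2) / 2)) ^ 2 = s ^ (d - 2) / (8 * lam) := by
  have h8 : (0 : ℝ) ≤ 8 * lam := by positivity
  rw [mul_pow, ← Real.rpow_natCast ((8 * lam) ^ (-(1 / 2 : ℝ))) 2, ← Real.rpow_mul h8,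
    ← Real.rpow_natCast (s ^ (((d : ℝ) - 2) / 2)) 2, ← Real.rpow_mul hs.le,
    show (-(1 / 2 : ℝ)) * ((2 : ℕ) : ℝ) = -1 by norm_num, show ((d : ℝ) - 2) / 2 * ((2 : ℕ) : ℝ) = ((d - 2 : ℕ) : ℝ) by
      rw [Nat.cast_sub hd]; push_cast; ring,
    Real.rpow_neg_one, Real.rpow_natCast]
  ring

/-- kernel: the LARGE-`L^kε` case of (4.5) (last line, `(L^{k−1}ε)^d ≧ λ`, which gives `λ ≤ (L^kε)^d` for `L ≥ 1`): if
`||φ| − (8λ)^{−1/2}(L^kε)^{(d−2)/2}| ≦ c(L^kε)⁻¹p(e_k)` then `0 ≤ P_k(φ) ≦ (c² + 2c⁴)p(e_k)⁴` (`λ_k = (L^kε)^{4−d}λ`, d = 2, 3, 4,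
`p(e_k) ≥ 1`) — via `P_k = λ_k(|φ|² − ρ₀²)²` and `λ_kρ₀² = (L^kε)²/8`. [cite: BalabanImbrieJaffe1988, (4.14) p.276] -/
theorem Pk_le_of_ring {lam s c pek : ℝ} (hlam : 0 < lam) (hs : 0 < s) {d : ℕ} (hd : 2 ≤ d) (hd' : d ≤ 4) (hc : 0 ≤ c)
    (hp : 1 ≤ pek) (hsd : lam ≤ s ^ d) (z : ℂ)
    (hz : |‖z‖ - (8 * lam) ^ (-(1 / 2 : ℝ)) * s ^ (((d : ℝ) - 2) / 2)| ≤ c * s⁻¹ * pek) :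
    Pk (s ^ (4 - d) * lam) s lam d z ≤ (c ^ 2 + 2 * c ^ 4) * pek ^ 4 := by
  set ρ : ℝ := (8 * lam) ^ (-(1 / 2 : ℝ)) * s ^ (((d : ℝ) - 2) / 2) with hρ_def
  set t : ℝ := c * s⁻¹ * pek with ht_def
  have hρ : 0 ≤ ρ := by positivity
  have ht : 0 ≤ t := by positivity
  have hρsq : ρ ^ 2 = s ^ (d - 2) / (8 * lam) := ringRadius_sq hlam hs hd
  -- P_k = λ_k (|z|² − ρ²)² = λ_k (|z| − ρ)² (|z| + ρ)²
  rw [Pk_eq_sq hlam.ne' hd hd', ← hρsq]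
  have h1 : (‖z‖ - ρ) ^ 2 ≤ t ^ 2 := by
    rw [← sq_abs (‖z‖ - ρ)]
    exact pow_le_pow_left₀ (abs_nonneg _) hz 2
  have h2 : (‖z‖ + ρ) ^ 2 ≤ (2 * ρ + t) ^ 2 := by
    have hzle : ‖z‖ ≤ ρ + t := by
      have := (abs_le.mp hz).2
      linarith
    exact pow_le_pow_left₀ (by positivity) (by linarith) 2
  have h3 : (2 * ρ + t) ^ 2 ≤ 2 * (4 * ρ ^ 2 + t ^ 2) := by nlinarith [sq_nonneg (2 * ρ - t)]
  have hlamk : 0 ≤ s ^ (4 - d) * lam := by positivity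
  -- λ_k ρ² = s²/8 and λ_k t⁴ ≤ c⁴ pek⁴
  have hkey1 : s ^ (4 - d) * lam * ρ ^ 2 = s ^ 2 / 8 := by
    rw [hρsq]
    have : (s ^ (4 - d) * s ^ (d - 2) : ℝ) = s ^ 2 := by rw [← pow_add]; congr 1; omega
    field_simp
    rw [← this]
  have hkey2 : s ^ (4 - d) * lam * t ^ 4 ≤ c ^ 4 * pek ^ 4 := by
    rw [ht_def]
    have hs4 : (s ^ (4 - d) : ℝ) * lam * (c * s⁻¹ * pek) ^ 4 = (lam / s ^ d) * (c ^ 4 * pek ^ 4) := by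
      have : (s ^ (4 - d) * s ^ d : ℝ) = s ^ 4 := by rw [← pow_add]; congr 1; omega
      field_simp
      rw [← this]
      try ring
    rw [hs4]
    have : lam / s ^ d ≤ 1 := div_le_one_of_le₀ hsd (by positivity)
    calc lam / s ^ d * (c ^ 4 * pek ^ 4) ≤ 1 * (c ^ 4 * pek ^ 4) := by gcongr
      _ = c ^ 4 * pek ^ 4 := one_mul _
  calc s ^ (4 - d) * lam * (‖z‖ ^ 2 - ρ ^ 2) ^ 2
      = s ^ (4 - d) * lam * ((‖z‖ - ρ) ^ 2 * (‖z‖ + ρ) ^ 2) := by ring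
    _ ≤ s ^ (4 - d) * lam * (t ^ 2 * (2 * (4 * ρ ^ 2 + t ^ 2))) := by
        gcongr s ^ (4 - d) * lam * ?_
        calc (‖z‖ - ρ) ^ 2 * (‖z‖ + ρ) ^ 2 ≤ t ^ 2 * (2 * ρ + t) ^ 2 := by gcongr
          _ ≤ t ^ 2 * (2 * (4 * ρ ^ 2 + t ^ 2)) := by gcongr
    _ = 8 * (s ^ (4 - d) * lam * ρ ^ 2) * t ^ 2 + 2 * (s ^ (4 - d) * lam * t ^ 4) := by ring
    _ = c ^ 2 * pek ^ 2 + 2 * (s ^ (4 - d) * lam * t ^ 4) := by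
        rw [hkey1, ht_def]; field_simp
    _ ≤ c ^ 2 * pek ^ 4 + 2 * (c ^ 4 * pek ^ 4) := by
        have hp2 : pek ^ 2 ≤ pek ^ 4 := pow_le_pow_right₀ hp (by norm_num)
        gcongr
    _ = (c ^ 2 + 2 * c ^ 4) * pek ^ 4 := by ring

/-- kernel: the SMALL-`L^kε` case of (4.5) (third line, `(L^{k−1}ε)^d < λ`, i.e. `(L^kε)^d < L^dλ`): if `|φ| ≦ cλ_k^{−1/4}p(e_k)` then
`|P_k(φ)| ≦ (c⁴ + ¼c²√(L^d) + L^d/64)·p(e_k)⁴` (`λ_k = (L^kε)^{4−d}λ`, d = 2, 3, 4, `p(e_k) ≥ 1`): term by term,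
`λ_k|φ|⁴ ≤ c⁴p⁴`, `¼(L^kε)²|φ|² ≤ ¼c²((L^kε)^d/λ)^{1/2}p² < ¼c²L^{d/2}p²`, `(L^kε)^d/(64λ) < L^d/64`. [cite: BalabanImbrieJaffe1988, (4.14) p.276] -/
theorem abs_Pk_le_of_small {lam s c pek L : ℝ} (hlam : 0 < lam) (hs : 0 < s) {d : ℕ} (hd : 2 ≤ d) (hd' : d ≤ 4)
    (hp : 1 ≤ pek) (hL : 0 ≤ L) (hsd : s ^ d < L ^ d * lam) (z : ℂ)
    (hz : ‖z‖ ≤ c * (s ^ (4 - d) * lam) ^ (-(1 / 4 : ℝ)) * pek) :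
    |Pk (s ^ (4 - d) * lam) s lam d z| ≤ (c ^ 4 + (1 / 4) * c ^ 2 * Real.sqrt (L ^ d) + L ^ d / 64) * pek ^ 4 := by
  set lamk : ℝ := s ^ (4 - d) * lam with hlamk_def
  have hlamk : 0 < lamk := by positivity
  have hz0 : 0 ≤ ‖z‖ := norm_nonneg z
  -- |z|⁴ ≤ c⁴ λ_k⁻¹ pek⁴
  have hz4 : lamk * ‖z‖ ^ 4 ≤ c ^ 4 * pek ^ 4 := by
    have h := pow_le_pow_left₀ hz0 hz 4
    have hr : ((lamk) ^ (-(1 / 4 : ℝ))) ^ 4 = lamk⁻¹ := by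
      rw [← Real.rpow_natCast (lamk ^ (-(1 / 4 : ℝ))) 4, ← Real.rpow_mul hlamk.le]
      norm_num
      exact Real.rpow_neg_one lamk
    rw [mul_pow, mul_pow, hr] at h
    calc lamk * ‖z‖ ^ 4 ≤ lamk * (c ^ 4 * lamk⁻¹ * pek ^ 4) := by gcongr
      _ = c ^ 4 * pek ^ 4 := by field_simp
  -- s²|z|² ≤ c² √(s^d/λ) pek² ≤ c² √(L^d) pek²
  have hz2 : s ^ 2 * ‖z‖ ^ 2 ≤ c ^ 2 * Real.sqrt (L ^ d) * pek ^ 2 := by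
    have h := pow_le_pow_left₀ hz0 hz 2
    have hr : s ^ 2 * ((lamk) ^ (-(1 / 4 : ℝ))) ^ 2 ≤ Real.sqrt (L ^ d) := by
      have hy0 : 0 ≤ s ^ 2 * ((lamk) ^ (-(1 / 4 : ℝ))) ^ 2 := by positivity
      rw [← Real.sqrt_sq hy0]
      apply Real.sqrt_le_sqrt
      have hr4 : (s ^ 2 * ((lamk) ^ (-(1 / 4 : ℝ))) ^ 2) ^ 2 = s ^ 4 * lamk⁻¹ := by
        rw [mul_pow, ← pow_mul, ← pow_mul, ← Real.rpow_natCast (lamk ^ (-(1 / 4 : ℝ))) (2 * 2),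
          ← Real.rpow_mul hlamk.le]
        norm_num
        left
        exact Real.rpow_neg_one lamk
      rw [hr4, hlamk_def]
      have hs4 : (s ^ 4 : ℝ) * (s ^ (4 - d) * lam)⁻¹ = s ^ d / lam := by
        have : (s ^ (4 - d) * s ^ d : ℝ) = s ^ 4 := by rw [← pow_add]; congr 1; omega
        field_simp
        rw [← this]
        try ring
      rw [hs4]
      exact (div_le_iff₀ hlam).mpr hsd.le
    rw [mul_pow, mul_pow] at h
    calc s ^ 2 * ‖z‖ ^ 2 ≤ s ^ 2 * (c ^ 2 * (lamk ^ (-(1 / 4 : ℝ))) ^ 2 * pek ^ 2) := by gcongr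
      _ = c ^ 2 * (s ^ 2 * (lamk ^ (-(1 / 4 : ℝ))) ^ 2) * pek ^ 2 := by ring
      _ ≤ c ^ 2 * Real.sqrt (L ^ d) * pek ^ 2 := by gcongr
  -- the constant term
  have hconst : 1 / (64 * lam) * s ^ d ≤ L ^ d / 64 := by
    rw [div_mul_eq_mul_div, one_mul, div_le_div_iff₀ (by positivity) (by norm_num)]
    nlinarith
  -- assemble: |P| ≤ λ_k|z|⁴ + ¼ s²|z|² + s^d/(64λ)
  have hP : |Pk lamk s lam d z| ≤ lamk * ‖z‖ ^ 4 + (1 / 4) * s ^ 2 * ‖z‖ ^ 2 + 1 / (64 * lam) * s ^ d := by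
    unfold Pk
    refine (abs_add_le _ _).trans ?_
    refine add_le_add ((abs_sub _ _).trans (le_of_eq ?_)) (le_of_eq (abs_of_nonneg (by positivity)))
    rw [abs_of_nonneg (by positivity), abs_of_nonneg (by positivity)]
  have hp2 : pek ^ 2 ≤ pek ^ 4 := pow_le_pow_right₀ hp (by norm_num)
  have hp4 : (1 : ℝ) ≤ pek ^ 4 := one_le_pow₀ hp
  calc |Pk lamk s lam d z| ≤ lamk * ‖z‖ ^ 4 + (1 / 4) * s ^ 2 * ‖z‖ ^ 2 + 1 / (64 * lam) * s ^ d := hP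
    _ ≤ c ^ 4 * pek ^ 4 + (1 / 4) * (c ^ 2 * Real.sqrt (L ^ d) * pek ^ 2) + L ^ d / 64 := by
        rw [mul_assoc (1 / 4 : ℝ)]
        gcongr
    _ ≤ c ^ 4 * pek ^ 4 + (1 / 4) * (c ^ 2 * Real.sqrt (L ^ d) * pek ^ 4) + L ^ d / 64 * pek ^ 4 := by
        gcongr
        · exact le_mul_of_one_le_right (by positivity) hp4
    _ = (c ^ 4 + (1 / 4) * c ^ 2 * Real.sqrt (L ^ d) + L ^ d / 64) * pek ^ 4 := by ring

/-- kernel: **the p. 276 claim from (4.5) + (4.14)** — for a field value `φ(x)` obeying the third or the fourth line of (4.5)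
(according to the case `(L^{k−1}ε)^d < λ` / `≧ λ`, read as `(L^kε)^d < L^dλ` / `λ ≦ (L^kε)^d`), `|P_k(φ(x))| ≦ C·p(e_k)⁴` with the
explicit constant `C = max(c² + 2c⁴, c⁴ + ¼c²√(L^d) + L^d/64)` — an instance of `Claim276`. [cite: BalabanImbrieJaffe1988, (4.14) p.276] -/
theorem claim276_of_restr45 {lam s c pek L : ℝ} (hlam : 0 < lam) (hs : 0 < s) {d : ℕ} (hd : 2 ≤ d) (hd' : d ≤ 4) (hc : 0 ≤ c)
    (hp : 1 ≤ pek) (hL : 0 ≤ L) :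
    Claim276 (max (c ^ 2 + 2 * c ^ 4) (c ^ 4 + (1 / 4) * c ^ 2 * Real.sqrt (L ^ d) + L ^ d / 64)) pek
      (Pk (s ^ (4 - d) * lam) s lam d)
      (fun z => (s ^ d < L ^ d * lam ∧ ‖z‖ ≤ c * (s ^ (4 - d) * lam) ^ (-(1 / 4 : ℝ)) * pek) ∨
        (lam ≤ s ^ d ∧ |‖z‖ - (8 * lam) ^ (-(1 / 2 : ℝ)) * s ^ (((d : ℝ) - 2) / 2)| ≤ c * s⁻¹ * pek)) := by
  intro z hz
  have hp4 : (0 : ℝ) ≤ pek ^ 4 := by positivity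
  rcases hz with ⟨hsd, hz⟩ | ⟨hsd, hz⟩
  · exact (abs_Pk_le_of_small hlam hs hd hd' hp hL hsd z hz).trans (by gcongr; exact le_max_right _ _)
  · rw [abs_of_nonneg (Pk_nonneg hlam hs.le hd hd' z)]
    exact (Pk_le_of_ring hlam hs hd hd' hc hp hsd z hz).trans (by gcongr; exact le_max_left _ _)

end

end Literature.MathematicalPhysics.QuantumFieldTheory.BalabanImbrieJaffe1984to88.BIJ88Sect4Statements
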